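import Literature.IUT.HodgeTheaters.ThetaPMEllNFHodgeTheatersD
import Literature.IUT.HodgeTheaters.ThetaPMEllNFHodgeTheatersToy

/-!
# [IUTchI] §6, Definition 6.13 (ii): the strict and the printed form of `𝒟-Θ^{±ell}NF`-Hodge theaters agree on isomorphisms

Mochizuki, *Inter-universal Teichmüller theory I*, §6, Remark 6.12.2 (ii) pp. 174–175 and Definition
6.13 (ii) p. 183, kurims manuscript (May 2020) ([IUTchI] Def 6.13 (ii) p.183) [claim: Mochizuki2012, status: disputed].
Companion to `ThetaPMEllNFHodgeTheaters.lean` (abc-iut-L5-t4: the strict rendering `S5Local.DThetaPMEllNFHT`),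
`ThetaPMEllNFHodgeTheatersIso.lean` (abc-iut-L5-t5: `DThetaPMEllNFHT.Iso`, `IsFullPolyIso`) and
`ThetaPMEllNFHodgeTheatersD.lean` (abc-iut-L5-t4: the printed triple `S5Local.DThetaPMEllNFHodgeTheater`,
its `Iso`, `DThetaPMEllNFHT.toHodgeTheater`): along the comparison `toHodgeTheater` (identity gluing) the
two isomorphism notions of Rmk 6.12.2 (ii) CORRESPOND BIJECTIVELY (`DThetaPMEllNFHT.Iso.toHodgeTheater`,
`isoToHodgeTheater_bijective`), so "the full poly-isomorphism" ([IUTchII] Cor 4.10 (iii), [IUTchIII]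
Def 1.1) means the same thing in either rendering; plus the definitional unfoldings of
`ThetaPMEllNFHT.toD` consumers rewrite with, and the toy Θ^{±ell}NF-Hodge theater's associated 𝒟-triple.
Nothing of the series is asserted.
-/

namespace Literature.IUT.HodgeTheaters

open CategoryTheory

universe u

namespace PMBaseKit

variable {l : ℕ} {K : PMBaseKit.{u} l} {M : K.MultKit} {FK : K.FKit M} {N : K.S5Local M FK}

namespace S5Local

/-! ### Unfolding `toD` and `toHodgeTheater` -/

/-- (a) of the associated `𝒟-Θ^{±ell}NF`-Hodge theater is the associated `𝒟-Θ^{±ell}`-Hodge theater ([IUTchI]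
Def 6.13 (ii) (a) p. 183; Def 6.11 (iii)). ([IUTchI] Def 6.13 (ii) p.183) [claim: Mochizuki2012, status: disputed] -/
@[simp] theorem ThetaPMEllNFHT.toD_pmEll (NI : N.IsoKit) {hl : Odd l} (X : N.ThetaPMEllNFHT hl) :
    (X.toD NI).pmEll = X.pmEll.dHT := rfl

/-- (b) of the associated `𝒟-Θ^{±ell}NF`-Hodge theater is the associated `𝒟-ΘNF`-Hodge theater ([IUTchI] Def
6.13 (ii) (b) p. 183; Def 5.5 (iii)). ([IUTchI] Def 6.13 (ii) p.183) [claim: Mochizuki2012, status: disputed] -/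
@[simp] theorem ThetaPMEllNFHT.toD_dnf (NI : N.IsoKit) {hl : Odd l} (X : N.ThetaPMEllNFHT hl) :
    (X.toD NI).dnf = NI.assocD X.thNF := rfl

/-- (c): the index identification of the associated gluing is that of the given gluing ([IUTchI] Def
6.13 (ii) (c) p. 183). ([IUTchI] Def 6.13 (ii) p.183) [claim: Mochizuki2012, status: disputed] -/
@[simp] theorem ThetaPMEllNFHT.toD_gluing_indexEquiv (NI : N.IsoKit) {hl : Odd l} (X : N.ThetaPMEllNFHT hl)
    (j : ULift.{u} (N.thJ X.thNF)) : (X.toD NI).gluing.indexEquiv j = X.gluing.indexEquiv j.down := rfl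

/-- The printed form of a strict `𝒟-Θ^{±ell}NF`-Hodge theater keeps (a) ([IUTchI] Def 6.13 (ii) p. 183).
([IUTchI] Def 6.13 (ii) p.183) [claim: Mochizuki2012, status: disputed] -/
@[simp] theorem DThetaPMEllNFHT.toHodgeTheater_pmEll {hl : Odd l} (X : N.DThetaPMEllNFHT hl) :
    X.toHodgeTheater.pmEll = X.pmEll := rfl

/-- … and (b) (its `𝒟-ΘNF`-Hodge theater on Proposition 6.7's output) ([IUTchI] Def 6.13 (ii) p. 183).
([IUTchI] Def 6.13 (ii) p.183) [claim: Mochizuki2012, status: disputed] -/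
@[simp] theorem DThetaPMEllNFHT.toHodgeTheater_dnf {hl : Odd l} (X : N.DThetaPMEllNFHT hl) :
    X.toHodgeTheater.dnf = X.dnf := rfl

/-- … with identity index identification ([IUTchI] Def 6.13 (ii) p. 183).
([IUTchI] Def 6.13 (ii) p.183) [claim: Mochizuki2012, status: disputed] -/
@[simp] theorem DThetaPMEllNFHT.toHodgeTheater_indexEquiv {hl : Odd l} (X : N.DThetaPMEllNFHT hl)
    (q : ULift.{u} X.pmEll.pmBridge.grpT.AbsStar) : X.toHodgeTheater.gluing.indexEquiv q = q.down := rfl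

/-- Strictification keeps (a) ([IUTchI] Def 6.13 (ii) p. 183). ([IUTchI] Def 6.13 (ii) p.183) [claim: Mochizuki2012, status: disputed] -/
@[simp] theorem DThetaPMEllNFHodgeTheater.strictify_pmEll {hl : Odd l} (law : N.GluingTransportLaw hl)
    (X : N.DThetaPMEllNFHodgeTheater hl) : (X.strictify law).pmEll = X.pmEll := rfl

/-! ### Isomorphisms: strict form versus printed form -/

/-- An isomorphism of strict `𝒟-Θ^{±ell}NF`-Hodge theaters (abc-iut-L5-t5's `DThetaPMEllNFHT.Iso`) IS an
isomorphism of their printed forms (same pair of isomorphisms, same index condition) ([IUTchI] Rmk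
6.12.2 (ii) p. 175). ([IUTchI] Rmk 6.12.2 (ii) p.175) [claim: Mochizuki2012, status: disputed] -/
def DThetaPMEllNFHT.Iso.toHodgeTheater {NI : N.IsoKit} {hl : Odd l} {X₁ X₂ : N.DThetaPMEllNFHT hl}
    (f : DThetaPMEllNFHT.Iso NI X₁ X₂) :
    DThetaPMEllNFHodgeTheater.Iso NI X₁.toHodgeTheater X₂.toHodgeTheater :=
  ⟨f.pm, f.nf, f.compat⟩

/-- Conversely, an isomorphism of the printed forms of two strict `𝒟-Θ^{±ell}NF`-Hodge theaters is an
isomorphism of the strict forms ([IUTchI] Rmk 6.12.2 (ii) p. 175). ([IUTchI] Rmk 6.12.2 (ii) p.175) [claim: Mochizuki2012, status: disputed] -/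
def DThetaPMEllNFHodgeTheater.Iso.ofHodgeTheater {NI : N.IsoKit} {hl : Odd l} {X₁ X₂ : N.DThetaPMEllNFHT hl}
    (f : DThetaPMEllNFHodgeTheater.Iso NI X₁.toHodgeTheater X₂.toHodgeTheater) :
    DThetaPMEllNFHT.Iso NI X₁ X₂ :=
  ⟨f.pm, f.nf, f.compat⟩

/-- **The two isomorphism notions of Rmk 6.12.2 (ii) correspond bijectively** along `toHodgeTheater`
([IUTchI] Rmk 6.12.2 (ii) p. 175): PROVED (the maps are mutually inverse field by field).
([IUTchI] Rmk 6.12.2 (ii) p.175) [claim: Mochizuki2012, status: disputed] -/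
theorem DThetaPMEllNFHT.isoToHodgeTheater_bijective (NI : N.IsoKit) {hl : Odd l} (X₁ X₂ : N.DThetaPMEllNFHT hl) :
    Function.Bijective
      (DThetaPMEllNFHT.Iso.toHodgeTheater : DThetaPMEllNFHT.Iso NI X₁ X₂ →
        DThetaPMEllNFHodgeTheater.Iso NI X₁.toHodgeTheater X₂.toHodgeTheater) :=
  Function.bijective_iff_has_inverse.2
    ⟨DThetaPMEllNFHodgeTheater.Iso.ofHodgeTheater, fun f => by cases f; rfl, fun f => by cases f; rfl⟩

/-- Hence a poly-isomorphism of strict `𝒟-Θ^{±ell}NF`-Hodge theaters is full iff its image between the printed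
forms is full — "the full poly-isomorphism" ([IUTchII] Cor 4.10 (iii), [IUTchIII] Def 1.1) means the same
in either rendering ([IUTchI] Rmk 6.12.2 (ii) p. 175). ([IUTchI] Rmk 6.12.2 (ii) p.175) [claim: Mochizuki2012, status: disputed] -/
theorem DThetaPMEllNFHT.isFullPolyIso_iff_image (NI : N.IsoKit) {hl : Odd l} {X₁ X₂ : N.DThetaPMEllNFHT hl}
    (P : Set (DThetaPMEllNFHT.Iso NI X₁ X₂)) :
    DThetaPMEllNFHT.IsFullPolyIso P ↔
      DThetaPMEllNFHodgeTheater.IsFullPolyIso (DThetaPMEllNFHT.Iso.toHodgeTheater '' P) := by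
  unfold DThetaPMEllNFHT.IsFullPolyIso DThetaPMEllNFHodgeTheater.IsFullPolyIso
  constructor
  · rintro rfl
    exact Set.image_univ_of_surjective (DThetaPMEllNFHT.isoToHodgeTheater_bijective NI X₁ X₂).2
  · intro h
    rw [← Set.preimage_image_eq P (DThetaPMEllNFHT.isoToHodgeTheater_bijective NI X₁ X₂).1, h,
      Set.preimage_univ]

end S5Local

/-! ### The toy Θ^{±ell}NF-Hodge theater's associated `𝒟`-triple -/

/-- The printed-form `𝒟-Θ^{±ell}NF`-Hodge theater type over the second toy ΘNF-side kit is inhabited by the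
ASSOCIATED `𝒟`-triple of the toy Θ^{±ell}NF-Hodge theater (`ThetaPMEllNFHT.toD` applied to
`S5Local.ThetaPMEllNFHT.toy`) — the passage `†ℋ𝒯^{Θ±ellNF} ↦ †ℋ𝒯^{𝒟-Θ±ellNF}` exercised on an inhabitant
([IUTchI] Def 6.13 (i), (ii) pp. 182–183). ([IUTchI] Def 6.13 (ii) p.183) [claim: Mochizuki2012, status: disputed] -/
theorem S5Local.nonempty_dThetaPMEllNFHodgeTheater_toyTheta (l : ℕ) [Fact l.Prime] (hl : l ≠ 2) (hlo : Odd l) :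
    Nonempty ((S5Local.toyTheta l hl).DThetaPMEllNFHodgeTheater hlo) :=
  ⟨(S5Local.ThetaPMEllNFHT.toy l hl hlo).toD (S5Local.IsoKit.toyTheta l hl)⟩

end PMBaseKit

end Literature.IUT.HodgeTheaters
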